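import Summits.BirchSwinnertonDyer.BirchSwinnertonDyer.Theses.PAdicOrder
import Summits.BirchSwinnertonDyer.BirchSwinnertonDyer.Theses.PAdicOrderV2
import Literature.NumberTheory.EllipticCurves.OrdinaryPrimesProofs
import Literature.NumberTheory.DiophantineGeometry.Conductor
import Literature.NumberTheory.EllipticCurves.PAdicGrossZagier
import Summits.BirchSwinnertonDyer.BirchSwinnertonDyer.Theorems.PAdicOrderV2PAdicOrderThesisR2StubUBRank0

/-!
# Skeleton — line `Sketch` (kato-sandwich-one-prime) for crux `PAdicOrderThesisR2` (stmt-0487)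

X := `Summit.BirchSwinnertonDyer.BirchSwinnertonDyer.Theses.PAdicOrderV2.PAdicOrderThesisR2`
(∀ E/ℚ globally minimal, ∃ good ordinary p, ∃ newform f of E:
 ord_T L_p(f, α_p, T) = r_an(E) ∧ ord_T L_p(f, α_p, T) = r_MW(E)).

Composition (`PAdicOrderThesisR2_of`, sorry-free modulo the `stub_*`): Kato's sandwich at one
prime, split by analytic rank.

* `stub_modularity` — modularity, INLINED exactly as the route's glue `CruxesToThesis` carries it
  (body of the cite-only fact `ModularForms.exists_isNewformOf`, BCDT 2001).
* `stub_kato` — the route's own support item `PAdicOrderKatoSideR2` (stmt-0491; Kato 2004 Thm 18.4: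
  r_MW ≤ ord_T L_p at odd good ordinary p).
* `stub_UB_rank0` — analytic rank 0: ord_T L_p = 0 at EVERY good ordinary p (interpolation:
  L_p(0) = (1-α⁻¹)² L(E,1)/Ω⁺ ≠ 0). CLOSED (p96136, imported).
* `stub_UB_pos` — analytic rank ≥ 1: ∃ good ordinary p ≥ 5 with ord_T L_p ≤ r_an (OnePrimeUB in
  positive rank; rank 1 = weak rank-one Schneider, rank ≥ 2 open).
* `stub_LB_rank1` — r_an = 1 ⇒ 1 ≤ r_MW (Gross–Zagier–Kolyvagin).
* `stub_LB_ge2` — 2 ≤ r_an ⇒ r_an ≤ r_MW (BSD lower bound in rank ≥ 2).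

Rank 0: r_MW ≤ ord = 0 = r_an (Kato + UB_rank0; LB is free).
Rank ≥ 1: r_MW ≤ ord ≤ r_an ≤ r_MW (Kato + UB_pos + LB).

STATUS after lead cycle 7 (2026-08-17, seat prover-line-stmt-BirchSwinnertonDyer-0487-c6-0):
composition and stub signatures unchanged (re-registered under seat c6; `lean check` rc 0, 5 sorries = the
5 open stubs); no stub refuted (Disproof cycle-1 FINAL, md5 b1ba74b1, unchanged since 2026-08-16T11:52Z;
no `stub-false` / `stub-misstated` evidence on the item); no blocker moved (no `_holds` for
`exists_isNewformOf` / `existsUnique_isNewformOf`, `kato_divisibility` /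
`kato_mordellWeilRank_le_order_padicLFunction`, `gross_zagier_rank_one_rat` /
`rank_eq_analyticRank_of_analyticRank_le_one`, `perrinRiou_padicGrossZagier`; sibling items
stmt-0489/0490/0491/0496/0501/0515/0144/0146/16217/16218 all open; acq-06588/06589 unfulfilled);
wave: none (unchanged reasons, seventh cycle). OUTCOME of this seat: LINE `Sketch` CLOSED AS DEAD under
prover L5(3) — it needs inputs its `Leans on:` cannot supply (card: "LB is imported; no point
construction inside the card"; nothing in print gives BSD-LB in analytic rank >= 2 = `stub_LB_ge2`, nor
OnePrimeUB in analytic rank >= 1 = `stub_UB_pos`) and no repair inside the line exists (`sandwich_tight`,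
p135275). The dead-line record `Lines/Sketch.dead.md` carries the kernel-checked INVARIANT binding every
future line: `stub_LB_ge2_of_thesis` / `analyticRank_eq_mordellWeilRank_of_thesis` (p100810) and
`thesis_iff_bsd_and_onePrimeComparison` (p136391) — X = BSDgm /\ OnePrimeComparison, so any line for X
contains the summit's lower-bound half and the one-prime upper bound; re-ideation cannot differ at the step
that died. The crux X is NOT claimed false. Planner (D-0014): X is the route thesis, an assembly over the
sibling cruxes + modularity; re-badge it (file modularity as a support item so `CruxesToThesis` derives X),
do not re-line it.

STATUS after lead cycle 6 (2026-08-17, seat prover-line-stmt-BirchSwinnertonDyer-0487-c5-0):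
composition and stub signatures unchanged (re-registered under seat c5; `lean check` rc 0, 5 sorries = the
5 open stubs); no stub refuted (Disproof cycle-1 FINAL, md5 b1ba74b1, unchanged since 2026-08-16T11:52Z;
no `stub-false` / `stub-misstated` evidence on the item); no blocker moved (no `_holds` for
`exists_isNewformOf` — fact-claim log: XL apex "Modularity, BCDT 2001 Thm A", in tree reduced only to
`theoremB ∧ CDT_theorem_7_2_4` —, `kato_divisibility`, `rank_eq_analyticRank_of_analyticRank_le_one` /
`gross_zagier_rank_one_rat`; acq-06588 Rubin 1992 / acq-06589 Bertrand 1982 still open, so the CM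
rank-one sector of `stub_UB_pos` stays parked); wave: none (the three delegable stubs are verbatim XL
facts whose status is unchanged — a worker can only answer `stub-blocked` again —, `stub_LB_ge2` is
summit-sized, `stub_UB_pos` is held and open). NEW: `Theorems/PAdicOrderV2PAdicOrderThesisR2StubNecessaryModularity.lean`
— the disprover's normal-form finding (n) as Theorems lemmas: `modularity_of_thesis : X → every globally
minimal elliptic W has a newform at some level` and, with Carayol `IsNewformOf.level_eq_conductorNorm`,
`X →` the body of `exists_isNewformOf` on globally minimal models; i.e. `stub_modularity` is NECESSARY for
X, not an artefact of the line. OUTCOME of this seat: the crux is parked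
`blocked-on: Literature.NumberTheory.EllipticCurves.ModularForms.exists_isNewformOf` (X implies it; every
cover of X in the tree — p100810, p106575, p134995 — takes it as a hypothesis; the other open stubs are the
sibling items stmt-0489/0490/0491/0501/0515/16218 with their own seats, or XL facts; a sixth line seat can
only re-derive this census). Planner (D-0014): X is the route thesis, auto-cruxed (`underived-target`) only
because `CruxesToThesis` (stmt-14877) carries modularity inline; filing modularity as a support item makes X
an item-derived target and ends line seats on it; `promote-stub stub_LB_ge2` (cycles 1–5) stands.

STATUS after lead cycle 5 (2026-08-17, seat prover-line-stmt-BirchSwinnertonDyer-0487-c4-0):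
composition and stub signatures unchanged (re-registered under seat c4; `lean check` rc 0, 5 sorries = the
5 open stubs); no stub refuted (Disproof cycle-1 FINAL, commit cccd1916a8dc, unchanged: no kill; no new
`stub-false`/`stub-misstated` evidence on the item); no blocker moved (still no `_holds` for
`exists_isNewformOf`, `kato_divisibility`, `gross_zagier_rank_one_rat` /
`rank_eq_analyticRank_of_analyticRank_le_one`; sibling cruxes stmt-0489/0490/0491/0496/0501/0515 and
LeadingTerm stmt-16217/16218 all open); wave: none (3 stubs blocked on those unchanged XL facts,
`stub_LB_ge2` crux-sized, `stub_UB_pos` held by the lead; its CM rank-one sector stays parked on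
acq-06589 Bertrand 1982 / acq-06588 Rubin 1992, both still open — the fact is not stated from a
secondary source). OUTCOME of this seat: the hand-back carried as a standing verdict since cycle 1 is
made the DONE outcome — `promote-stub stub_LB_ge2`. Grounds, all landed: `stub_LB_ge2` (2 ≤ r_an ⇒
r_an ≤ r_MW) is the lower-bound half of BSD in analytic rank ≥ 2, NECESSARY for X (`X → BSDgm`,
`thesis_iff_bsd_and_onePrime` / StubWiring p100810), free of p-adic content, implied by the existing
items HigherGZConstructionR2 (stmt-0501, via the Gram lemma), SqueezeLBplusOne ∧ SqueezeParity
(stmt-0144 ∧ 0146), SelmerRank's chain, LeadingTerm `Consistency ∧ PinchPrime` (p134995); with it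
promoted, the skeleton is CLOSED MODULO EXISTING ITEMS AND NAMED FACTS:
`padicOrderThesisR2_of_items : exists_isNewformOf → PAdicOrderKatoSideR2 (0491) →
PAdicOrderComparisonR2 (0489) → gross_zagier_rank_one_rat → HigherGZConstructionR2 (0501) → X`
(p100810) and `X₅ ↔ BSDgm ∧ PinchPrime (16218)` (p134995) — i.e. X is an assembly over sibling cruxes,
not a crux with content of its own beyond them; planner: re-badge X as derived from {0489 or 16218,
0491, 0501 (or BSDgm)} + the three facts, or restate it as X₅ conditional on BSD-LB.

STATUS after lead cycle 4 (2026-08-17, seat prover-line-stmt-BirchSwinnertonDyer-0487-c3-0):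
composition and stub signatures unchanged (re-registered under seat c3); no stub refuted (Disproof
cycle-1 FINAL, commit cccd1916a8dc, unchanged: no kill); no blocker moved (no `_holds` for
`exists_isNewformOf`, `kato_divisibility`, `gross_zagier_rank_one_rat`; wave: none). NEW (both ACCEPTED):
(i) `Theorems/PAdicOrderV2PAdicOrderThesisR2StubLeadingTermItems.lean` (p134995) — the crux against the
sibling route LeadingTerm opened 2026-08-16: `X ⟸ PinchPrime ∧ BSDgm` (PinchPrime's `∃f` discharges the
modularity debt), `X ⟸ Consistency ∧ PinchPrime ∧ SqueezeUBR2` (LeadingTerm's crux set settles this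
route's thesis, via its certified `closes`), `stub_LB_ge2`/`stub_LB_rank1 ⟸ Consistency ∧ PinchPrime`
(closed `LBOfCruxes` + the junk-robust step `L^{(r_MW)}(E,1) ≠ 0 ⇒ r_an ≤ r_MW`), the `∃f`-form of
`stub_UB_pos ⟸ PinchPrime ∧ SqueezeUBR2`, conversely `PinchPrime ⟸` sandwich stubs + modularity, and the
NORMAL FORM `X₅ ↔ BSDgm ∧ PinchPrime` (`X₅` = `X` with witness prime `≥ 5`; the height datum is free by
`exists_isCanonical_holds`): PinchPrime is EXACTLY the Mordell–Weil-side one-prime conjunct of `X₅`.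
(ii) `Theorems/PAdicOrderV2PAdicOrderThesisR2StubTightness.lean` (p135275) — the line is TIGHT: the
composition proves `X₅` (`thesisFiveLe_of_sandwich`), and conversely `X₅ ⇒` every open stub
(`stub_UB_pos`, `stub_modularity` modulo Carayol `IsNewformOf.level_eq_conductorNorm`; the LB stubs
outright), so `sandwich_tight : Carayol → Kato → (X₅ ↔ stub_modularity ∧ stub_UB_pos ∧ stub_LB_rank1 ∧
stub_LB_ge2)` — no stub can be weakened, nothing is hidden. Literature: acq-06588 (Rubin 1992),
acq-06589 (Bertrand 1982) filed for the CM rank-one sector of `stub_UB_pos` (the only in-print slice not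
yet vendored). Verdict carried: `stub_LB_ge2` crux-sized (promote-stub standing; now also covered by
LeadingTerm `Consistency ∧ PinchPrime`); planner: restate X as X₅ (`5 ≤ p`) at the next tenure pass.

STATUS after lead cycle 3 (2026-08-16, seat prover-line-stmt-BirchSwinnertonDyer-0487-c2-0):
composition and stub signatures unchanged (re-registered under seat c2); no stub refuted (Disproof
cycle-1 FINAL, commit cccd1916a8dc: no kill). NEW, unconditional (`Theorems/PAdicOrderV2PAdicOrderThesisR2StubUBPosEnvelope.lean`):
the proved ENVELOPE of `stub_UB_pos` — at EVERY good ordinary `p` and for every newform `f`,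
`ord_T L_p(f, α_p, T) < ⊤` (`padicLFunction_ne_zero_holds`), `ord ≡ r_an (mod 2)`
(`stub_even_order_iff_even_analyticRank`), `ord = 0 ↔ r_an = 0`, hence the DICHOTOMY
`ord ≤ r_an ∨ r_an + 2 ≤ ord`: the stub can fail at a prime only by an even defect `≥ 2`, its upper
bound at `p` is the open condition `T^{r_an+2} ∤ L_p(E,T)`, and `stub_UB_pos ⟸ ∃p ∀f, ord < r_an + 2`
(`stub_UB_pos_of_order_lt_add_two`); for `r_an ≤ 2` moreover `r_an ≤ ord`, so `ord = r_an ∨ r_an + 2 ≤ ord`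
(rank 1: `ord = 1 ∨ 3 ≤ ord`; rank 2: `ord = 2 ∨ 4 ≤ ord`). Item-level cover of the open residue completed
(`Theorems/PAdicOrderV2PAdicOrderThesisR2StubSiblingItems.lean`, p106575): UB ∈ {#2 stmt-0489, #5 stmt-0515 (rank 1),
#3 stmt-0490 ∧ SqueezeUBR2 stmt-0496}, LB ∈ {HigherGZConstructionR2 stmt-0501, SqueezeLBplusOne stmt-0144 ∧ SqueezeParity
stmt-0146, GZK (rank 1)}; `X ⟸ modularity ∧ #3 ∧ BSDgm` (no #2). Verdict of the lead stands: `stub_LB_ge2` is crux-sized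
(BSD lower bound in rank ≥ 2, necessary for X, no p-adic content) — promote / share with Squeeze, HigherGrossZagier, SelmerRank.

STATUS after lead cycle 2 (2026-08-16, seat prover-line-stmt-BirchSwinnertonDyer-0487-c1-0):
composition unchanged; no stub refuted (Disproof cycles 1–2: no kill, `X ↔ BSDgm ∧ OnePrimeComparison`).
Wiring of the open stubs to EXISTING items (`Theorems/PAdicOrderV2PAdicOrderThesisR2StubWiring.lean`,
p100810): `stub_UB_pos ⟸ PAdicOrderComparisonR2` (crux #2, stmt-0489; rank-1 case ⟸ crux #5 stmt-0515);
`stub_LB_ge2`, `stub_LB_rank1` are NECESSARY (`X → r_an = r_MW` for gm models);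
`stub_LB_ge2 ⟸ hasEntireLFunction_rat ∧ HigherGZConstructionR2` (stmt-0501, via the proved Gram lemma);
hence `padicOrderThesisR2_of_items : exists_isNewformOf → PAdicOrderKatoSideR2 → PAdicOrderComparisonR2 →
gross_zagier_rank_one_rat → HigherGZConstructionR2 → X`. Open residue modulo named facts =
{crux #2 (∃p-weakening), BSD lower bound in rank ≥ 2}; `stub_LB_ge2` handed back as crux-sized (promote-stub).
-/

-- single-conjunct summit: `Summit.BirchSwinnertonDyer.BirchSwinnertonDyer.…` repeats the name by design
set_option linter.dupNamespace false

namespace Summit.BirchSwinnertonDyer.BirchSwinnertonDyer.Cruxes.PAdicOrderThesisR2.KatoSandwich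

open Literature.NumberTheory.EllipticCurves Literature.NumberTheory.EllipticCurves.ModularForms
open Summit.BirchSwinnertonDyer.BirchSwinnertonDyer.Theses.PAdicOrderV2

-- STATUS (wave 1, 2026-08-16): stub-blocked on the cite-only named fact
-- `Literature.NumberTheory.EllipticCurves.ModularForms.exists_isNewformOf` (no `_holds` in tree).
/-- Stub (modularity, inlined as in `CruxesToThesis`): every elliptic `W/ℚ` has a newform of
level `N_W` (BCDT 2001 Thm A; = `ModularForms.exists_isNewformOf`, `Iff.rfl`). -/
theorem stub_modularity :
    ∀ (W : WeierstrassCurve ℚ) [W.IsElliptic] [NeZero (W.conductorNorm ℤ)],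
      ∃ f : CuspForm (CongruenceSubgroup.Gamma0 (W.conductorNorm ℤ)) 2, IsNewformOf W f := by
  sorry

-- STATUS (wave 1): stub-blocked on `kato_mordellWeilRank_le_order_padicLFunction` (← XL fact
-- `kato_divisibility`; tree: `pAdicOrderV2KatoSideR2_of_kato_divisibility`).
/-- Stub (Kato side): the route support item `PAdicOrderKatoSideR2` (stmt-BirchSwinnertonDyer-0491;
Kato 2004 Thm 18.4): `p ≠ 2` good ordinary, `f` newform of `W` ⇒ `r_MW ≤ ord_T L_p(f, α_p, T)`. -/
theorem stub_kato : PAdicOrderKatoSideR2 := by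
  sorry

-- stub_UB_rank0 : CLOSED — landed as
-- `Summit.BirchSwinnertonDyer.BirchSwinnertonDyer.Cruxes.PAdicOrderThesisR2.KatoSandwich.stub_UB_rank0`
-- (Theorems/PAdicOrderV2PAdicOrderThesisR2StubUBRank0.lean, p96136, imported above):
--   ∀ W p, IsOrdinaryAt W p → W.analyticRank = 0 → ∀ f, IsNewformOf W f →
--     (padicLFunction f (unitRoot W p : ℚ_[p])).order = 0

-- STATUS (lead): OPEN PROBLEM — rank 1 ⇔ ∃ ordinary p ≥ 5 with h_p(P) ≠ 0 (weak rank-one Schneider,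
-- `PAdicHeightBarrier`; open for non-CM E), rank ≥ 2: one Taylor coefficient ≠ 0 at one prime.
-- Known halves landed: r_an = 0 ⇒ ord = 0 (`stub_UB_rank0`), r_an ≠ 0 ⇒ ord ≥ 1
-- (`one_le_order_padicLFunction_of_analyticRank_ne_zero`, same Theorems file).
-- Cycle 3 (envelope, `…StubUBPosEnvelope.lean`, unconditional): at every good ordinary p,
-- ord < ⊤, ord ≡ r_an (mod 2), and `ord ≤ r_an ∨ r_an + 2 ≤ ord`; so the conclusion below at p is
-- EQUIVALENT to `ord < r_an + 2` (`T^{r_an+2} ∤ L_p(E,T)`), cf. `stub_UB_pos_of_order_lt_add_two`.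
/-- Stub (OnePrimeUB, positive analytic rank): if `r_an(W) ≥ 1` there is a good ordinary prime
`p ≥ 5` at which, for every newform `f` of `W`, `ord_T L_p(f, α_p, T) ≤ r_an(W)`. -/
theorem stub_UB_pos :
    ∀ (W : WeierstrassCurve ℚ) [W.IsElliptic] [W.IsGloballyMinimal], 0 < W.analyticRank →
      ∃ (p : ℕ) (_ : Fact p.Prime), 5 ≤ p ∧ IsOrdinaryAt W p ∧
        ∀ {N : ℕ} [NeZero N] (f : CuspForm (CongruenceSubgroup.Gamma0 N) 2), IsNewformOf W f →
          (padicLFunction f (unitRoot W p : ℚ_[p])).order ≤ (W.analyticRank : ℕ∞) := by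
  sorry

-- STATUS (wave 1): stub-blocked on `rank_eq_analyticRank_of_analyticRank_le_one` (GZK); conditional
-- `stub_LB_rank1_of_rank_eq_analyticRank` / `…_of_gross_zagier_rank_one_rat` landed (p96175).
/-- Stub (LB, analytic rank 1): `r_an(W) = 1 ⇒ 1 ≤ r_MW(W)` (Gross–Zagier 1986 + Kolyvagin 1990:
the Heegner point is non-torsion). -/
theorem stub_LB_rank1 :
    ∀ (W : WeierstrassCurve ℚ) [W.IsElliptic] [W.IsGloballyMinimal],
      W.analyticRank = 1 → 1 ≤ W.mordellWeilRank := by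
  sorry

-- STATUS (wave 1): OPEN PROBLEM — no Literature fact implies it (lower-bound half of BSD in rank ≥ 2;
-- `HeegnerPointBarrier`, `SelmerRankBarrier`); = the LB crux of Squeeze / HigherGrossZagier / SelmerRank.
/-- Stub (LB, analytic rank ≥ 2): `2 ≤ r_an(W) ⇒ r_an(W) ≤ r_MW(W)` (lower-bound half of BSD). -/
theorem stub_LB_ge2 :
    ∀ (W : WeierstrassCurve ℚ) [W.IsElliptic] [W.IsGloballyMinimal],
      2 ≤ W.analyticRank → W.analyticRank ≤ W.mordellWeilRank := by
  sorry

/-- **Composition.** The crux `PAdicOrderThesisR2` from the six stubs: take the newform `f` of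
level `N_W` (`stub_modularity`, with `NeZero N_W` from `conductorNorm_pos_holds`); in analytic
rank 0 take any good ordinary `p ≥ 5` (`exists_good_ordinary_prime_holds`), where
`ord = 0 = r_an` (`stub_UB_rank0`) and `r_MW ≤ ord = 0` (`stub_kato`); in positive rank take the
prime of `stub_UB_pos` and close the sandwich `r_MW ≤ ord ≤ r_an ≤ r_MW` with `stub_kato` and
`stub_LB_rank1` / `stub_LB_ge2`. -/
theorem PAdicOrderThesisR2_of : PAdicOrderThesisR2 := by
  intro W _ _
  haveI hN : NeZero (W.conductorNorm ℤ) := ⟨(W.conductorNorm_pos_holds).ne'⟩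
  obtain ⟨f, hf⟩ := stub_modularity W
  rcases Nat.eq_zero_or_pos W.analyticRank with h0 | hpos
  · obtain ⟨p, hp, h5, hgood, hord⟩ := WeierstrassCurve.exists_good_ordinary_prime_holds W
    have hO : IsOrdinaryAt W p := ⟨hgood, hord⟩
    have hub : (padicLFunction f (unitRoot W p : ℚ_[p])).order = 0 := stub_UB_rank0 W p hO h0 f hf
    have hk : (W.mordellWeilRank : ℕ∞) ≤ (padicLFunction f (unitRoot W p : ℚ_[p])).order :=
      stub_kato W p (by omega) hO f hf
    refine ⟨p, hp, hO, W.conductorNorm ℤ, hN, f, hf, ?_, ?_⟩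
    · rw [hub, h0, Nat.cast_zero]
    · refine le_antisymm ?_ hk
      rw [hub]
      exact zero_le
  · obtain ⟨p, hp, h5, hO, hub⟩ := stub_UB_pos W hpos
    have hLB : W.analyticRank ≤ W.mordellWeilRank := by
      rcases Nat.lt_or_ge W.analyticRank 2 with h1 | h2
      · have h1' : W.analyticRank = 1 := by omega
        rw [h1']
        exact stub_LB_rank1 W h1'
      · exact stub_LB_ge2 W h2
    have h1 : (W.mordellWeilRank : ℕ∞) ≤ (padicLFunction f (unitRoot W p : ℚ_[p])).order :=
      stub_kato W p (by omega) hO f hf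
    have h2 : (padicLFunction f (unitRoot W p : ℚ_[p])).order ≤ (W.analyticRank : ℕ∞) := hub f hf
    have h3 : (W.analyticRank : ℕ∞) ≤ (W.mordellWeilRank : ℕ∞) := by exact_mod_cast hLB
    exact ⟨p, hp, hO, W.conductorNorm ℤ, hN, f, hf, le_antisymm h2 (h3.trans h1),
      le_antisymm (h2.trans h3) h1⟩

/-- **Composition, route `PAdicOrder` spelling** (the crux item stmt-0487 is wanted by both
routes under byte-identical decls; `Iff.rfl`). -/
theorem PAdicOrderThesisR2_proof :
    Summit.BirchSwinnertonDyer.BirchSwinnertonDyer.Theses.PAdicOrder.PAdicOrderThesisR2 :=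
  PAdicOrderThesisR2_of

end Summit.BirchSwinnertonDyer.BirchSwinnertonDyer.Cruxes.PAdicOrderThesisR2.KatoSandwich
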